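/-
Copyright (c) 2026 the pub-hodgecm-mathlib formalisation cell (harness21).  Prover seat hodgecm-mathlib-LH4-p06 (g4), Track A «(D-RAM) FOUR-FRAME», unit U2H, the census leaf
(ρ2b′-X) — T5c «TORIC LEVEL CENSUS, M∕E-RAMIFIED»: Mars' index on the Θ-fixed units along a NON-ISOMETRIC (order-compatible) embedding of the third field; ramified-capable twin
of LH4-p08 (g4)'s ★ p857326 `QuadraticOrderTorusIndices.relIndex_thetaFixed_depth_eq_pow` (same proof, the isometry binder weakened to order-compatibility).  2026-09-04.
-/
import Literature.NumberTheory.LocalFields.WildQuadraticDatumUnitDepthIndex   -- ★ p857227 (LH4-p08 (g4)): Mars' index in valued currency, `relIndex_eq_pow_of_depth`, `exists_subgroup_depth`, `exists_subgroup_v_eq_one`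
import HarnessLib

/-!
# Mars' index `[Ũ : Ṽ_{d′+2m}] = q^m` on the `Θ`-fixed units of `M`, along an ORDER-COMPATIBLE embedding `jK : K♮ →+* M` — the case `M ∕ K♮` RAMIFIED
(Flicker 1998 Prop. 7 p. 84 ∕ §6 p. 95 REMARK (Mars); Serre, *Local Fields* Ch. V §3)

Topic `NumberTheory/LocalFields`; namespace `Literature.NumberTheory.LocalFields.QuadraticOrder` (= ★ T4 ∕ LH4-p08 (g4)'s F4 organs ★ p857298∕p857299∕p857326).  THEOREMS ONLY (no
definition, no instance, no notation, no named fact, no `sorry`); kernel lane `--supports stmt-HodgeConjecture-24833` (count-neutral).  Cell `pub/hodgecm-mathlib` (D-0151), crux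
H413, Track A «(D-RAM) FOUR-FRAME», unit U2H: in the toric ∕ order reduction of the WILD type-(2) fixed-point census (ρ2b′-X) the Θ-side indices `[Ũ : Ṽ_r]` of the norm-depth
subgroups are Mars' index on the third field `K♮ = M^Θ` (F0P3-p01 (g32) RamM INDEX-LEMMAS (L-RM3∕4); LH4-p12 (g4) T5-FRAME F2).  ★ p857326 transports ★ p857227 along an
ISOMETRIC `jK` (`|jK x| = |x|`: the frame where `M ∕ K♮` is UNRAMIFIED — type U).  In type RamM (and on the K-side of type RamK) `M ∕ K♮` is RAMIFIED, `|jK π′|_M = exp(−2)`, and no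
isometric embedding exists; but the transport needs only ORDER-COMPATIBILITY **`|jK x| ≤ |jK y| ↔ |x| ≤ |y|`** (every embedding of discretely valued fields compatible with the
valuations, `|jK x|_M = |x|^{e}`), since the subgroup `Ṽ` is bounded by `|jK π′^{d′+2m}|` — an image value.  THIS FILE is that one-binder generalisation (proof = ★ p857326's, two
rewrites changed); T5a recovers the isometric case by `fun x y => by rw [hiso, hiso]`.
* `v_eq_one_iff_of_le_iff` — order-compatibility gives `|jK x| = 1 ↔ |x| = 1`.
* **`relIndex_thetaFixed_depth_eq_pow_of_le_iff`** — `Ṽ.relIndex Ũ = q^m` for `Ũ = {Θz = z ∧ |z| = 1}`, `Ṽ = Ũ ∩ {|z − ρz| ≤ |jK π′^{d′+2m}|}`, `q = #𝓀[K♮]`.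
HONEST LABEL: HC_CM is proved only modulo the 7 printed citations (2 remaining named inputs: hLiu418 = stmt-HodgeConjecture-24832, h413 = stmt-HodgeConjecture-24833) until rung 0
closes; unconditional algebra, count-neutral (Θ-side index organ of the RamM census; no census value asserted).

## References
* [Flicker1998UnitaryFL] Y. Z. Flicker, *Elementary proof of the fundamental lemma for a unitary group*, Canad. J. Math. 50 (1998): Prop. 7 p. 84; §6 p. 95 REMARK (Mars' index).
* [Serre1979] J.-P. Serre, *Local Fields*, GTM 67 (1979): Ch. V §3 (the unit filtration of a ramified quadratic extension), Ch. II §2 (extensions of valuations).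
-/

set_option autoImplicit false

open WithZero IsLocalRing
open scoped Valued
open Literature.NumberTheory.LocalFields.WildQuadraticDatum

namespace Literature.NumberTheory.LocalFields.QuadraticOrder

variable {K K' : Type*} [Field K] [Valued K ℤᵐ⁰] [Field K'] [Valued K' ℤᵐ⁰] {ρ Θ : K →+* K} {σ' : K' →+* K'} {π' : K'} {d : ℕ}

/-- ORDER-COMPATIBILITY GIVES UNITS ↔ UNITS: `|jK x| = 1 ↔ |x| = 1` (compare with `1 = jK 1` both ways). [cite: Serre1979, Ch. II §2] -/
theorem v_eq_one_iff_of_le_iff (jK : K' →+* K) (hjv : ∀ x y : K', Valued.v (jK x) ≤ Valued.v (jK y) ↔ Valued.v x ≤ Valued.v y) (x : K') :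
    Valued.v (jK x) = 1 ↔ Valued.v x = 1 := by
  have h1 := hjv x 1
  have h2 := hjv 1 x
  rw [map_one, map_one] at h1 h2
  rw [map_one] at h1 h2
  constructor
  · intro h; exact le_antisymm (h1.1 h.le) (h2.1 h.ge)
  · intro h; exact le_antisymm (h1.2 h.le) (h2.2 h.ge)

/-- **MARS' INDEX ON THE THIRD FIELD, READ IN `Mˣ`, ALONG AN ORDER-COMPATIBLE EMBEDDING** (`M ∕ K♮` ramified allowed): `K′ = K♮` carries a ramified quadratic datum
`(σ′, π′, d)`; `jK : K′ →+* M` is an embedding ONTO the `Θ`-fixed elements with `jK ∘ σ′ = ρ ∘ jK` and **`|jK x| ≤ |jK y| ↔ |x| ≤ |y|`**; then for subgroups `Ũ, Ṽ ≤ Mˣ` with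
`z ∈ Ũ ↔ Θz = z ∧ |z| = 1` and `z ∈ Ṽ ↔ Θz = z ∧ |z| = 1 ∧ |z − ρz| ≤ |jK π′ ^ (d+2m)|`: **`Ṽ.relIndex Ũ = q^m`**, `q = #𝓀[K′]` (★ p857227 on `K′`, transported along the
injective `Units.map jK`; = ★ p857326 `relIndex_thetaFixed_depth_eq_pow` with the isometry weakened). [cite: Flicker1998UnitaryFL, Prop. 7 p. 84; §6 p. 95 REMARK] [cite: Serre1979, Ch. V §3] -/
theorem relIndex_thetaFixed_depth_eq_pow_of_le_iff
    (hσ' : ∀ x, σ' (σ' x) = x) (hvσ' : ∀ x, Valued.v (σ' x) = Valued.v x) (hfix' : ∀ x : K', σ' x = x → x ≠ 0 → ∃ n : ℤ, Valued.v x = exp (2 * n))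
    (hπ' : Valued.v π' = exp (-1 : ℤ)) (hdd' : Valued.v (π' - σ' π') = Valued.v π' ^ d) [IsDiscreteValuationRing 𝒪[K']] [Finite 𝓀[K']] {q : ℕ} (hq : Nat.card 𝓀[K'] = q)
    (jK : K' →+* K) (hjv : ∀ x y : K', Valued.v (jK x) ≤ Valued.v (jK y) ↔ Valued.v x ≤ Valued.v y) (hjΘ : ∀ x, Θ (jK x) = jK x)
    (hjfix : ∀ z : K, Θ z = z → ∃ x, jK x = z) (hjσ : ∀ x, jK (σ' x) = ρ (jK x)) (m : ℕ) (Ut Vt : Subgroup Kˣ)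
    (hUt : ∀ z, z ∈ Ut ↔ Θ (z : K) = z ∧ Valued.v (z : K) = 1)
    (hVt : ∀ z, z ∈ Vt ↔ Θ (z : K) = z ∧ Valued.v (z : K) = 1 ∧ Valued.v ((z : K) - ρ z) ≤ Valued.v (jK π' ^ (d + 2 * m))) :
    Vt.relIndex Ut = q ^ m := by
  obtain ⟨U', hU'⟩ := exists_subgroup_v_eq_one (K := K')
  obtain ⟨V', hV'⟩ := exists_subgroup_depth hσ' hvσ' hπ' (d + 2 * m)
  have hj1 := v_eq_one_iff_of_le_iff jK hjv
  set f : K'ˣ →* Kˣ := Units.map (jK : K' →* K) with hf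
  have hinj : Function.Injective f := by
    intro a b hab
    have := congrArg (fun u : Kˣ => (u : K)) hab
    simp only [hf, Units.coe_map, MonoidHom.coe_coe] at this
    exact Units.ext (jK.injective this)
  -- a `Θ`-fixed unit of `M` is the image of a unit of `K′`
  have hlift : ∀ z : Kˣ, Θ (z : K) = z → ∃ w : K'ˣ, f w = z := by
    intro z hz
    obtain ⟨x, hx⟩ := hjfix z hz
    have hx0 : x ≠ 0 := fun h0 => by rw [h0, map_zero] at hx; exact z.ne_zero hx.symm
    exact ⟨Units.mk0 x hx0, Units.ext (by simp [hf, hx])⟩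
  -- the depth bound transported: `|jK w − ρ jK w| ≤ |jK π'^(d+2m)| ↔ |w − σ' w| ≤ |π'^(d+2m)|`
  have hdepth : ∀ w : K', Valued.v (jK w - ρ (jK w)) ≤ Valued.v (jK π' ^ (d + 2 * m)) ↔
      Valued.v (σ' w - w) ≤ Valued.v (π' ^ (d + 2 * m)) := by
    intro w
    rw [← hjσ, ← map_sub, ← map_pow, hjv, Valuation.map_sub_swap]
  have hUt' : Ut = U'.map f := by
    ext z
    rw [hUt, Subgroup.mem_map]
    constructor
    · rintro ⟨hz, hz1⟩
      obtain ⟨w, rfl⟩ := hlift z hz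
      refine ⟨w, (hU' w).2 ?_, rfl⟩
      have : Valued.v ((f w : Kˣ) : K) = 1 := hz1
      rwa [hf, Units.coe_map, MonoidHom.coe_coe, hj1] at this
    · rintro ⟨w, hw, rfl⟩
      rw [hU'] at hw
      exact ⟨by rw [hf, Units.coe_map, MonoidHom.coe_coe, hjΘ], by rw [hf, Units.coe_map, MonoidHom.coe_coe, hj1]; exact hw⟩
  have hVt' : Vt = V'.map f := by
    ext z
    rw [hVt, Subgroup.mem_map]
    constructor
    · rintro ⟨hz, hz1, hzd⟩
      obtain ⟨w, rfl⟩ := hlift z hz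
      refine ⟨w, (hV' w).2 ⟨?_, ?_⟩, rfl⟩
      · have : Valued.v ((f w : Kˣ) : K) = 1 := hz1
        rwa [hf, Units.coe_map, MonoidHom.coe_coe, hj1] at this
      · rw [hf, Units.coe_map, MonoidHom.coe_coe, hdepth] at hzd
        exact hzd
    · rintro ⟨w, hw, rfl⟩
      obtain ⟨hw1, hwd⟩ := (hV' w).1 hw
      refine ⟨by rw [hf, Units.coe_map, MonoidHom.coe_coe, hjΘ], by rw [hf, Units.coe_map, MonoidHom.coe_coe, hj1]; exact hw1, ?_⟩
      rw [hf, Units.coe_map, MonoidHom.coe_coe, hdepth]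
      exact hwd
  rw [hUt', hVt', Subgroup.relIndex_map_map_of_injective _ _ hinj]
  exact relIndex_eq_pow_of_depth hσ' hvσ' hfix' hπ' hdd' hq m U' V' hU' hV'

end Literature.NumberTheory.LocalFields.QuadraticOrder
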